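import Summits.CriticalPhenomena.SAWScalingLimit.Theses.SAWWeldingIdentification
import Summits.CriticalPhenomena.SAWScalingLimit.Theorems.SAWWeldingIdentificationAssembly22

/-!
# Route SAWWeldingIdentification — the assembly item `Assembly2` (stmt-CriticalPhenomena-4510)

The assembly statement of route `SAWWeldingIdentification` of the sub-problem `SAWScalingLimit`
is the implication

`WeldingLawOfLimit → RemovableLimit → EventualTight → WeldingSetup → WeldingRigidity →
SLERemovableChord → IdentifyFromWelding → LimitUpgrade → ChordalSLE83Exists → SAWScalingLimit`,

which is *literally* the type of the route file's proved deciding theorem `closes`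
(standard reductions: completion of the Dobrushin domain to a conformal rectangle, the chordal
SLE(8/3) curve and its law, Lusin–Souslin identification from the welding law, Prokhorov upgrade).
Hence the item was closed by the term `closes`; no new mathematics and no Literature fact enter.

2026-08-16: the route decl `…Theses.SAWWeldingIdentification.Assembly2` was dropped from the route
file by the multi-assembly lint (2026-08-16T14:43Z; kept: `Assembly` = stmt-CriticalPhenomena-11048,
proved by `sawWeldingIdentification_assembly_proof`; the item stmt-4510 stays recorded as proved by
`sawWeldingIdentification_assembly2_proof`), so `theorem sawWeldingIdentification_assembly2_proof :
…Assembly2` stopped elaborating ("Unknown identifier" in the full builds). The identical chain,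
spelled out verbatim, has since landed as `assembly22_chain_proof := closes`
(`SAWWeldingIdentificationAssembly22.lean`, the sibling record `Assembly22` dropped by the same lint);
this append-only file therefore keeps its one name as a deprecated alias of that theorem rather than
restating the chain a third time, and records (`assembly2_signature_iff_assembly`, `Iff.rfl`) that the
dropped item's signature is the kept decl `Assembly`.
-/

namespace Summit.CriticalPhenomena.SAWScalingLimit.Theorems

open Summit.CriticalPhenomena.SAWScalingLimit.Theses.SAWWeldingIdentification in
/-- **Record of the dropped route item `Assembly2`** = stmt-CriticalPhenomena-4510 (ledger signature
verbatim, left): it is, definitionally, the route's kept assembly decl `Assembly`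
(stmt-CriticalPhenomena-11048, proved by `sawWeldingIdentification_assembly_proof`) — which is why the
multi-assembly lint of 2026-08-16 could drop it without loss. -/
theorem assembly2_signature_iff_assembly :
    (WeldingLawOfLimit → RemovableLimit → EventualTight → WeldingSetup → WeldingRigidity →
      SLERemovableChord → IdentifyFromWelding → LimitUpgrade → ChordalSLE83Exists → SAWScalingLimit) ↔
      Summit.CriticalPhenomena.SAWScalingLimit.Theses.SAWWeldingIdentification.Assembly :=
  Iff.rfl

/-- Deprecated name: **assembly of route SAWWeldingIdentification** (item stmt-CriticalPhenomena-4510,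
former decl `Assembly2`): the cruxes `WeldingLawOfLimit`, `RemovableLimit`, `EventualTight` together
with the supports `WeldingSetup`, `WeldingRigidity`, `SLERemovableChord`, `IdentifyFromWelding`,
`LimitUpgrade`, `ChordalSLE83Exists` imply `SAWScalingLimit` — the deciding theorem `closes` of the
route file. The decl `Assembly2` was dropped from the route file 2026-08-16 (multi-assembly lint), so
the statement is now carried, unfolded, by `assembly22_chain_proof` (same chain, same proof `closes`). -/
@[deprecated assembly22_chain_proof (since := "2026-08-16")]
alias sawWeldingIdentification_assembly2_proof := assembly22_chain_proof

end Summit.CriticalPhenomena.SAWScalingLimit.Theorems
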